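import Summits.ValiantsHypothesis.ValiantsHypothesis.Theorems.GrenetZeonDualUnipotentThreeHalvesLongMassNilSpaceJacobson
import Summits.ValiantsHypothesis.ValiantsHypothesis.Theorems.GrenetZeonDualUnipotentThreeHalvesLongMassPerPencilPrice
import Summits.ValiantsHypothesis.ValiantsHypothesis.Theorems.GrenetZeonTwoDimCoefficientsDualUnipotentEngelRung

/-!
# `GrenetZeon.TwoDimCoefficients` (stmt-ValiantsHypothesis-8062), stub `stub_dualUnipotent` — the JACOBSON RUNG:
# `per_n = tr(N^{n−1} M)` over a WEAKLY CLOSED (e.g. Jordan-closed) nil value space forces `m ≳ n^{3/2}/2`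

leafhand-val-grenetzeon-2 gen31 (32nd hand), 2026-09-01; 8062-side twin of the (c)-row ✓ `…LongMassNilSpaceJacobson` (Jacobson's theorem on
weakly closed nil spaces, N. Jacobson, *Lie Algebras*, Ch. II §2 Thm. 1, proved there in the kernel for subspaces of `M_b(ℂ)`).

The located open point of `stub_dualUnipotent : DualUnipotentBound` is the WILD (non-triangularisable) nilpotent pencil.  Triangularisable pencils
give `m ≳ n^{3/2}/2` through the per-pencil price bridge ✓ `PerPencilPrice.le_of_relCert_of_perPoly_eq_trace`; the by-name SOURCES of
triangularisable value spaces so far were: an explicit flag, vanishing words, Engel (Lie-closed), Radjavi (permutable trace).  This file adds the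
weakest algebraic closure hypothesis that still forces a flag — WEAK CLOSURE: for all `A, B` in the value space `V` some scalar `γ` has
`AB + γ·BA ∈ V` (`γ = −1` Lie, `γ = 0` nil algebra, `γ = +1` JORDAN-closed).

* ★ `le_of_perPoly_eq_trace_weaklyClosed` — `per_n = tr(N^{n−1}M)`, `N`, `M` affine, values of `N` in a weakly closed nil space ⇒ `n(n−1) ≤ 2⌊√n⌋·m`.
* `le_of_perPoly_eq_trace_jordanClosed` — the Jordan case.
* `sq_le_of_trace_pow_mul_weaklyClosed` — the `(q, k)`-family form `n² ≤ 2kn + m·q` (any exponent `d`), via ✓ `DualUnipotentEngelRung`.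
So a width-`o(n^{3/2})` dual-unipotent representation of `per_n` has a value space `V` with a pair `A, B` whose whole line `AB + γ·BA` (`γ ∈ ℂ`)
misses `V`: one more excluded species for 8062 by name (the wild core is untouched).

Honest framing.  Helper (`--supports stmt-ValiantsHypothesis-8062`); nothing here proves `DualUnipotentBound`, `TwoDimCoefficients`, 24318 or
`VP ≠ VNP` — OPEN / NOT proved.  Def-free, no sorry. [cite: Jacobson1962LieAlgebras, Ch. II §2 Thm. 1]
-/

set_option linter.dupNamespace false
set_option autoImplicit false

noncomputable section

namespace Summit.ValiantsHypothesis.ValiantsHypothesis.Theorems.GrenetZeon.NilSpaceJacobson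

open MvPolynomial Matrix
open scoped BigOperators
open Literature.Computability.AlgebraicComplexity (perPoly)
open Summit.ValiantsHypothesis.ValiantsHypothesis.Cruxes.TwoDimCoefficients.DimTwoCases (AffMat IsAffine)
open Summit.ValiantsHypothesis.ValiantsHypothesis.Theorems.GrenetZeon.SlowCore (RelCert)
open Summit.ValiantsHypothesis.ValiantsHypothesis.Theorems.GrenetZeon.PerPencilPrice (le_of_relCert_of_perPoly_eq_trace)
open Summit.ValiantsHypothesis.ValiantsHypothesis.Theorems.GrenetZeon.DualUnipotentEngelRung (sq_le_of_trace_pow_mul_valueSpace_conj)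

variable {n m : ℕ}

/-- ★ **JACOBSON RUNG (floor form, constant 2).**  If `per_n = tr(N^{n−1}·M)` with affine `m × m` pencils and the values of `N` lie in a nil
space `V ≤ M_m(ℂ)` that is weakly closed (`∀ A B ∈ V, ∃ γ, AB + γ·BA ∈ V`), then `n(n−1) ≤ 2⌊√n⌋·m`, i.e. `m ≳ n^{3/2}/2`.
[cite: Jacobson1962LieAlgebras, Ch. II §2 Thm. 1] -/
theorem le_of_perPoly_eq_trace_weaklyClosed (N M : AffMat n m) (hN : IsAffine N) (hM : IsAffine M)
    (hper : perPoly (Fin n) ℂ = (N ^ (n - 1) * M).trace)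
    (V : Submodule ℂ (Matrix (Fin m) (Fin m) ℂ)) (hV : ∀ x : Fin n × Fin n → ℂ, N.map (MvPolynomial.eval x) ∈ V)
    (hnil : ∀ A ∈ V, IsNilpotent A) (hwc : ∀ A ∈ V, ∀ B ∈ V, ∃ γ : ℂ, A * B + γ • (B * A) ∈ V) :
    n * (n - 1) ≤ 2 * (Nat.sqrt n * m) :=
  le_of_relCert_of_perPoly_eq_trace N M hM hper (relCert_of_valueSpace_weaklyClosed N hN V hV hnil hwc)

/-- **JORDAN RUNG**: values of `N` in a Jordan-closed nil space (`AB + BA ∈ V`) ⇒ `n(n−1) ≤ 2⌊√n⌋·m`. [cite: Jacobson1962LieAlgebras, Ch. II §2 Thm. 1] -/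
theorem le_of_perPoly_eq_trace_jordanClosed (N M : AffMat n m) (hN : IsAffine N) (hM : IsAffine M)
    (hper : perPoly (Fin n) ℂ = (N ^ (n - 1) * M).trace)
    (V : Submodule ℂ (Matrix (Fin m) (Fin m) ℂ)) (hV : ∀ x : Fin n × Fin n → ℂ, N.map (MvPolynomial.eval x) ∈ V)
    (hnil : ∀ A ∈ V, IsNilpotent A) (hjordan : ∀ A ∈ V, ∀ B ∈ V, A * B + B * A ∈ V) :
    n * (n - 1) ≤ 2 * (Nat.sqrt n * m) :=
  le_of_relCert_of_perPoly_eq_trace N M hM hper (relCert_of_valueSpace_jordanClosed N hN V hV hnil hjordan)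

/-- ★ **JACOBSON RUNG, `(q, k)`-family form** (any exponent `d`): `per_n = tr(N^d·M)`, values of `N` in a weakly closed nil space ⇒
`n² ≤ 2kn + m·q` for all `q ≥ 1`, `m ≤ kq` (the rung `m ≳ n^{3/2}/(2√2)` of ✓ `DualUnipotentEngelRung.sq_le_of_trace_pow_mul_valueSpace_conj`).
[cite: Jacobson1962LieAlgebras, Ch. II §2 Thm. 1] -/
theorem sq_le_of_trace_pow_mul_weaklyClosed {d q k : ℕ}
    (N M : Matrix (Fin m) (Fin m) (MvPolynomial (Fin n × Fin n) ℂ))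
    (hN : ∀ i j, (N i j).totalDegree ≤ 1) (hM : ∀ i j, (M i j).totalDegree ≤ 1)
    (V : Submodule ℂ (Matrix (Fin m) (Fin m) ℂ)) (hV : ∀ x : Fin n × Fin n → ℂ, N.map (MvPolynomial.eval x) ∈ V)
    (hnil : ∀ A ∈ V, IsNilpotent A) (hwc : ∀ A ∈ V, ∀ B ∈ V, ∃ γ : ℂ, A * B + γ • (B * A) ∈ V)
    (hper : perPoly (Fin n) ℂ = (N ^ d * M).trace) (hq : 1 ≤ q) (hmk : m ≤ k * q) :
    n ^ 2 ≤ k * (2 * n) + m * q := by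
  obtain ⟨u, hu⟩ := exists_unit_conj_strictUpper_of_weaklyClosed V hnil hwc
  exact sq_le_of_trace_pow_mul_valueSpace_conj N M hN hM V hV u hu hper hq hmk

/-- **No cheap weakly closed model of the permanent (contrapositive, by name).**  If `per_n = tr(N^{n−1}·M)` with affine pencils of width `m`
and `2⌊√n⌋·m < n(n−1)`, then the nil value space `V` of `N` (any nil space containing all values) is NOT weakly closed: some `A, B ∈ V` have
`AB + γ·BA ∉ V` for every scalar `γ`. [cite: Jacobson1962LieAlgebras, Ch. II §2 Thm. 1] -/
theorem exists_pair_not_weaklyClosed_of_perPoly_eq_trace (N M : AffMat n m) (hN : IsAffine N) (hM : IsAffine M)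
    (hper : perPoly (Fin n) ℂ = (N ^ (n - 1) * M).trace)
    (V : Submodule ℂ (Matrix (Fin m) (Fin m) ℂ)) (hV : ∀ x : Fin n × Fin n → ℂ, N.map (MvPolynomial.eval x) ∈ V)
    (hnil : ∀ A ∈ V, IsNilpotent A) (hsmall : 2 * (Nat.sqrt n * m) < n * (n - 1)) :
    ∃ A ∈ V, ∃ B ∈ V, ∀ γ : ℂ, A * B + γ • (B * A) ∉ V := by
  by_contra h
  push Not at h
  exact absurd (le_of_perPoly_eq_trace_weaklyClosed N M hN hM hper V hV hnil h) (not_le.mpr hsmall)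

end Summit.ValiantsHypothesis.ValiantsHypothesis.Theorems.GrenetZeon.NilSpaceJacobson

end
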